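import Literature.NumberTheory.LFunctions.LogFreeDensityDHLemmaB
import Literature.NumberTheory.LFunctions.LogFreeDensityMeanValueW
import Literature.NumberTheory.LFunctions.SiegelZeroExceptionalPrimesProofs
import HarnessLib

/-!
# Bombieri's Lemme C: the Deuring–Heilbronn weights are small on average over the sifted range

Topic `Literature/NumberTheory/LFunctions`, sub-namespace `LogFreeDensity`. Everything here is
PROVED (theorems only; no definitions, no named facts). Reproduction of published work:
E. Bombieri, *Le grand crible dans la théorie analytique des nombres*, Astérisque 18 (2ᵉ éd. 1987),
§6, LEMME C and its use in the proof of THÉORÈME 14, second assertion (pp. 48–52): if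
`β₁ = 1 − δ₁` is an exceptional zero of `L(s, χ₁)` (`χ₁` real primitive mod `q₁`), the weights
`w(n) = Λ(n)(1 + χ₁(n) n^{−δ₁})/2` of the "deuxième cas" (`LogFreeDensity.dhW`) satisfy, on the
sifted prime powers `n ∈ (x^{a₀}, x]`, `p ∣ n ⇒ p > z` (`LogFreeDensity.siftedSet`, `z ≥ q₁`),

  `∑_{n ∈ G, n ≤ t} w(n)²/n ≤ C_C (δ₁ (log x)³ + (log x)²/z)`            (`lemmeC_sifted`),

which carries the factor `δ₁ log x` relative to the bound `2 (log x)²` used for the first assertion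
(`LogFreeDensityTheorem14.lean`, proof of `middleRange`). The saving comes from the primes:
`w(p)² ≤ (log p)² ((1 + χ₁(p) p^{−δ₁})/2) ≤ (log p)² (𝟙[χ₁(p) ≠ −1] + δ₁ log p)` (`dhW_sq_le`,
`one_add_mul_rpow_le_of_prime`), and the exceptional primes `p* > q₁` (`χ₁(p*) ≠ −1`) have
`∑_{q₁ < p* ≤ x} 1/p* ≪ δ₁ log x` — in the tree this is Tao–Teräväinen's Proposition 3.5 (3.13),
PROVED as `SiegelZero.TaoTeravainen2021_eq313_holds` (`SiegelZeroExceptionalPrimesProofs.lean`),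
which is the modern printed form of Bombieri's Lemme C ("si `L(β₁, χ₁) = 0` … `∑ (1 + χ₁(p))/p`
est petit"). The proper prime powers `p^k`, `k ≥ 2`, `p > z`, contribute `≤ 2(log x)²/z`
(`sum_inv_properPrimePow_gt_le`); the assembly of Théorème 14 disposes of this term with the
lower bound `δ₁ ≫ q₁^{−ε}` (Siegel).

## References
* [Bombieri1987GrandCrible] E. Bombieri, *Le grand crible dans la théorie analytique des nombres*,
  Astérisque 18 (1987), §6, Lemme C and Théorème 14 (pp. 48–52).
* [TaoTeravainen2021] T. Tao, J. Teräväinen, *The Hardy–Littlewood–Chowla conjecture in the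
  presence of a Siegel zero*, J. London Math. Soc. 106 (2022), Proposition 3.5 (3.13).
-/

noncomputable section

open Complex Finset Filter Real
open scoped LSeries.notation ArithmeticFunction.vonMangoldt Topology Nat

namespace Literature.NumberTheory.LFunctions.LogFreeDensity

open Literature.NumberTheory.LFunctions Literature.NumberTheory.LFunctions.SiegelZero

/-! ### The weights at primes and prime powers -/

/-- `w(n)² ≤ Λ(n)² · (1 + χ₁(n) n^{−δ₁})/2` (since `0 ≤ 1 + χ₁(n) n^{−δ₁} ≤ 2`). [cite: Bombieri1987GrandCrible, §6 Lemme C] -/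
theorem dhW_sq_le {r : ℕ} (χ₁ : DirichletCharacter ℂ r) {δ₁ : ℝ} (hδ : 0 ≤ δ₁) (n : ℕ) :
    dhW χ₁ δ₁ n ^ 2 ≤ Λ n ^ 2 * ((1 + (χ₁ n).re * (n : ℝ) ^ (-δ₁)) / 2) := by
  unfold dhW
  set u : ℝ := 1 + (χ₁ n).re * (n : ℝ) ^ (-δ₁) with hu
  have h1 := abs_re_apply_le_one χ₁ n
  have h2 := natCast_rpow_neg_le_one n hδ
  have h3 : 0 ≤ (n : ℝ) ^ (-δ₁) := Real.rpow_nonneg (Nat.cast_nonneg n) _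
  have hprod : |(χ₁ n).re * (n : ℝ) ^ (-δ₁)| ≤ 1 := by
    rw [abs_mul, abs_of_nonneg h3]; nlinarith [abs_nonneg (χ₁ n).re]
  have hu0 : 0 ≤ u := by rw [hu]; have := neg_abs_le ((χ₁ n).re * (n : ℝ) ^ (-δ₁)); linarith
  have hu2 : u ≤ 2 := by rw [hu]; have := le_abs_self ((χ₁ n).re * (n : ℝ) ^ (-δ₁)); linarith
  have hΛ : 0 ≤ Λ n := ArithmeticFunction.vonMangoldt_nonneg
  have key : (u / 2) ^ 2 ≤ u / 2 := by nlinarith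
  calc (Λ n * u / 2) ^ 2 = Λ n ^ 2 * (u / 2) ^ 2 := by ring
    _ ≤ Λ n ^ 2 * (u / 2) := mul_le_mul_of_nonneg_left key (by positivity)

/-- At a prime `p`: `(1 + χ₁(p) p^{−δ₁})/2 ≤ 𝟙[χ₁(p) ≠ −1] + δ₁ log p`
(if `χ₁(p) = −1` then `1 − p^{−δ₁} = 1 − e^{−δ₁ log p} ≤ δ₁ log p`). [cite: Bombieri1987GrandCrible, §6 Lemme C] -/
theorem one_add_mul_rpow_le_of_prime {r : ℕ} (χ₁ : DirichletCharacter ℂ r) {δ₁ : ℝ} (hδ : 0 ≤ δ₁)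
    {p : ℕ} (hp : p.Prime) :
    (1 + (χ₁ p).re * (p : ℝ) ^ (-δ₁)) / 2 ≤
      (if χ₁ (p : ZMod r) ≠ -1 then (1 : ℝ) else 0) + δ₁ * Real.log p := by
  have hp0 : (0 : ℝ) < p := by exact_mod_cast hp.pos
  have hlog : 0 ≤ Real.log p := Real.log_natCast_nonneg p
  have h3 : 0 ≤ (p : ℝ) ^ (-δ₁) := Real.rpow_nonneg hp0.le _
  by_cases h : χ₁ (p : ZMod r) ≠ -1
  · rw [if_pos h]
    have h1 := abs_re_apply_le_one χ₁ p
    have h2 := natCast_rpow_neg_le_one p hδ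
    have : (χ₁ p).re * (p : ℝ) ^ (-δ₁) ≤ 1 := by
      have := le_abs_self ((χ₁ p).re); nlinarith
    nlinarith
  · push Not at h
    rw [if_neg (not_not.2 h), h]
    have hre : ((-1 : ℂ)).re = -1 := by simp
    rw [hre]
    -- `1 − p^{−δ₁} ≤ δ₁ log p`
    have hexp : (p : ℝ) ^ (-δ₁) = Real.exp (-(δ₁ * Real.log p)) := by
      rw [Real.rpow_def_of_pos hp0]; ring_nf
    have h1 : 1 - δ₁ * Real.log p ≤ (p : ℝ) ^ (-δ₁) := by
      rw [hexp]; linarith [Real.add_one_le_exp (-(δ₁ * Real.log p))]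
    nlinarith

/-- `Λ(n)² ≤ (log N)²` for `1 ≤ n ≤ N`. [folklore] -/
theorem vonMangoldt_sq_le_log_sq {n N : ℕ} (hn : 1 ≤ n) (hnN : n ≤ N) :
    Λ n ^ 2 ≤ Real.log N ^ 2 := by
  have h0 : 0 ≤ Λ n := ArithmeticFunction.vonMangoldt_nonneg
  have h1 : Λ n ≤ Real.log N :=
    ArithmeticFunction.vonMangoldt_le_log.trans
      (Real.log_le_log (by exact_mod_cast hn) (by exact_mod_cast hnN))
  exact pow_le_pow_left₀ h0 h1 2

/-! ### Proper prime powers with a large least prime factor -/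

/-- **The proper prime powers `p^k ≤ N`, `k ≥ 2`, `p > z`, have reciprocal sum `≤ 2/z`**:
`∑ 1/p^k ≤ ∑_{p > z} (1/p²)/(1 − 1/p) ≤ 2 ∑_{m > z} 1/m² ≤ 2/z`. [folklore] -/
theorem sum_inv_properPrimePow_gt_le {z N : ℕ} (hz : 1 ≤ z) :
    ∑ n ∈ (Ioc 0 N).filter (fun n => IsPrimePow n ∧ ¬ n.Prime ∧ z < n.minFac), (1 : ℝ) / n ≤
      2 / z := by
  classical
  set T := (Ioc 0 N).filter (fun n => IsPrimePow n ∧ ¬ n.Prime ∧ z < n.minFac) with hT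
  rcases lt_or_ge N z with hNz | hzN
  · -- no such `n`: `minFac n ≤ n ≤ N < z`
    have hTe : T = ∅ := by
      rw [hT, Finset.filter_eq_empty_iff]
      intro n hn h
      obtain ⟨-, -, hmin⟩ := h
      rw [mem_Ioc] at hn
      have := Nat.minFac_le hn.1
      omega
    rw [hTe, sum_empty]; positivity
  set emb : ℕ → ℕ × ℕ := fun n => (n.minFac, n.factorization n.minFac) with hemb
  set g : ℕ × ℕ → ℝ := fun y => ((1 : ℝ) / y.1) ^ y.2 with hg
  have hTmem : ∀ n ∈ T, IsPrimePow n ∧ ¬ n.Prime ∧ z < n.minFac ∧ 0 < n ∧ n ≤ N := by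
    intro n hn
    simp only [hT, mem_filter, mem_Ioc] at hn
    exact ⟨hn.2.1, hn.2.2.1, hn.2.2.2, hn.1.1, hn.1.2⟩
  have hspec : ∀ n ∈ T, n.minFac.Prime ∧ 2 ≤ n.factorization n.minFac ∧
      n.minFac ^ n.factorization n.minFac = n := by
    intro n hn
    obtain ⟨hpp, hnp, -, -, -⟩ := hTmem n hn
    have hp : n.minFac.Prime := Nat.minFac_prime hpp.ne_one
    have he : n.minFac ^ n.factorization n.minFac = n := hpp.minFac_pow_factorization_eq
    refine ⟨hp, ?_, he⟩
    by_contra hk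
    push Not at hk
    interval_cases h : n.factorization n.minFac
    · rw [pow_zero] at he; exact hpp.ne_one he.symm
    · rw [pow_one] at he; exact hnp (he ▸ hp)
  have hinj : Set.InjOn emb (T : Set ℕ) := by
    intro n hn n' hn' h
    obtain ⟨-, -, e⟩ := hspec n hn
    obtain ⟨-, -, e'⟩ := hspec n' hn'
    simp only [hemb, Prod.mk.injEq] at h
    obtain ⟨h1, h2⟩ := h
    rw [← e, ← e', h2, h1]
  have himage : T.image emb ⊆ ((Ioc z N).filter Nat.Prime) ×ˢ Icc 2 N := by
    intro y hy
    rw [mem_image] at hy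
    obtain ⟨n, hn, rfl⟩ := hy
    obtain ⟨-, -, hmin, hn0, hnN⟩ := hTmem n hn
    obtain ⟨hp, hk, e⟩ := hspec n hn
    simp only [hemb, mem_product, mem_filter, mem_Ioc, mem_Icc]
    refine ⟨⟨⟨hmin, (Nat.minFac_le hn0).trans hnN⟩, hp⟩, hk, ?_⟩
    calc n.factorization n.minFac ≤ 2 ^ n.factorization n.minFac := (Nat.lt_two_pow_self).le
      _ ≤ n.minFac ^ n.factorization n.minFac := Nat.pow_le_pow_left hp.two_le _
      _ = n := e
      _ ≤ N := hnN
  have hsum : ∑ n ∈ T, (1 : ℝ) / n = ∑ n ∈ T, g (emb n) := by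
    refine sum_congr rfl fun n hn => ?_
    obtain ⟨-, -, e⟩ := hspec n hn
    simp only [hg, hemb]
    conv_lhs => rw [← e]
    push_cast
    rw [one_div_pow]
  have hg0 : ∀ y ∈ ((Ioc z N).filter Nat.Prime) ×ˢ Icc 2 N, 0 ≤ g y := fun y _ => by
    simp only [hg]; positivity
  have hzR : (0 : ℝ) < z := by exact_mod_cast hz
  calc ∑ n ∈ T, (1 : ℝ) / n = ∑ n ∈ T, g (emb n) := hsum
    _ = ∑ y ∈ T.image emb, g y := (sum_image hinj).symm
    _ ≤ ∑ y ∈ ((Ioc z N).filter Nat.Prime) ×ˢ Icc 2 N, g y :=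
        sum_le_sum_of_subset_of_nonneg himage fun y hy _ => hg0 y hy
    _ = ∑ p ∈ (Ioc z N).filter Nat.Prime, ∑ k ∈ Icc 2 N, ((1 : ℝ) / p) ^ k := by
        rw [sum_product]
    _ ≤ ∑ p ∈ (Ioc z N).filter Nat.Prime, 2 * (((p : ℕ) : ℝ) ^ 2)⁻¹ := by
        refine sum_le_sum fun p hp => ?_
        have hp2 : (2 : ℝ) ≤ p := by exact_mod_cast (mem_filter.1 hp).2.two_le
        have h0 : (0 : ℝ) ≤ 1 / p := by positivity
        have h1 : (1 : ℝ) / p < 1 := by rw [div_lt_one (by linarith)]; linarith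
        have hp1 : (1 : ℝ) / p ≤ 1 / 2 := by
          rw [div_le_div_iff₀ (by linarith) (by norm_num)]; linarith
        calc ∑ k ∈ Icc 2 N, ((1 : ℝ) / p) ^ k
            = ∑ k ∈ Ico 2 (N + 1), ((1 : ℝ) / p) ^ k := by rfl
          _ ≤ ((1 : ℝ) / p) ^ 2 / (1 - 1 / p) := geom_sum_Ico_le_of_lt_one h0 h1
          _ ≤ ((1 : ℝ) / p) ^ 2 / (1 / 2) := by
              refine div_le_div_of_nonneg_left (by positivity) (by norm_num) (by linarith)
          _ = 2 * ((p : ℝ) ^ 2)⁻¹ := by rw [one_div_pow, one_div]; ring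
    _ ≤ ∑ m ∈ Ioc z N, 2 * ((m : ℝ) ^ 2)⁻¹ :=
        sum_le_sum_of_subset_of_nonneg (filter_subset _ _) fun m _ _ => by positivity
    _ = 2 * ∑ m ∈ Ioc z N, ((m : ℝ) ^ 2)⁻¹ := by rw [mul_sum]
    _ ≤ 2 * ((z : ℝ)⁻¹ - (N : ℝ)⁻¹) :=
        mul_le_mul_of_nonneg_left (sum_Ioc_inv_sq_le_sub (by omega) hzN) (by norm_num)
    _ ≤ 2 / z := by
        rw [div_eq_mul_inv]
        have : (0 : ℝ) ≤ (N : ℝ)⁻¹ := by positivity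
        linarith

/-! ### Lemme C on the sifted range -/

/-- The sifted set consists of prime powers `n` with `1 ≤ n ≤ ⌊x⌋` and `minFac n > z`. [folklore] -/
theorem mem_siftedSet_iff {x : ℝ} {z n : ℕ} :
    n ∈ siftedSet x z ↔ (⌊x ^ expoB⌋₊ < n ∧ n ≤ ⌊x⌋₊) ∧ IsPrimePow n ∧ z < n.minFac := by
  rw [siftedSet, mem_filter, mem_Ioc]

set_option maxHeartbeats 800000 in
/-- **Bombieri's LEMME C on the sifted range** (*Le grand crible*, §6, pp. 48–52, the weights of
the "deuxième cas"): there are absolute `c_C, C_C > 0` such that for every primitive quadratic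
`χ₁ ≠ χ₀` mod `q₁` and every real zero `β₁ < 1` of `L(s, χ₁)` with `(1 − β₁) log q₁ ≤ c_C`, all
`x ≥ 1` with `log x ≥ 4`, all naturals `z ≥ q₁`, `z ≥ 1`, and all `t`,
`∑_{n ∈ G, n ≤ t} w(n)²/n ≤ C_C ((1 − β₁)(log x)³ + (log x)²/z)`, where `G` is the set of prime
powers in `(⌊x^{a₀}⌋, ⌊x⌋]` free of prime factors `≤ z` (`LogFreeDensity.siftedSet x z`) and
`w = Λ(1 + χ₁ n^{−(1−β₁)})/2` (`LogFreeDensity.dhW χ₁ (1 − β₁)`). The prime part is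
Tao–Teräväinen's (3.13) (`SiegelZero.TaoTeravainen2021_eq313_holds`, `ε = 1`), the prime powers
`sum_inv_properPrimePow_gt_le`. [cite: Bombieri1987GrandCrible, §6 Lemme C] [cite: TaoTeravainen2021, Proposition 3.5 (3.13)] -/
theorem lemmeC_sifted :
    ∃ c_C C_C : ℝ, 0 < c_C ∧ 0 < C_C ∧
      ∀ (q₁ : ℕ) [NeZero q₁] (χ₁ : DirichletCharacter ℂ q₁), χ₁ ≠ 1 → χ₁.IsPrimitive →
        χ₁.IsQuadratic → ∀ β₁ : ℝ, β₁ < 1 → χ₁.LFunction β₁ = 0 →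
        (1 - β₁) * Real.log q₁ ≤ c_C →
        ∀ (x : ℝ) (z : ℕ), 1 ≤ x → 4 ≤ Real.log x → q₁ ≤ z → 1 ≤ z → (z : ℝ) ≤ x →
        ∀ t : ℝ,
          ∑ n ∈ (siftedSet x z).filter (fun n => n ≤ ⌊t⌋₊), dhW χ₁ (1 - β₁) n ^ 2 / n ≤
            C_C * ((1 - β₁) * Real.log x ^ 3 + Real.log x ^ 2 / z) := by
  classical
  obtain ⟨K, η₀, hTT⟩ := TaoTeravainen2021_eq313_holds 1 one_pos
  set η₁ : ℝ := max η₀ 1 with hη₁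
  have hη₁pos : 0 < η₁ := lt_of_lt_of_le one_pos (le_max_right _ _)
  set K' : ℝ := max K 0 with hK'
  have hK'0 : 0 ≤ K' := le_max_right _ _
  refine ⟨1 / η₁, K' + 4, by positivity, by positivity,
    fun q₁ _ χ₁ hχ₁ hprim hquad β₁ hβ₁ hzero hsmall x z hx hlogx hqz hz1 hzx t => ?_⟩
  set δ₁ : ℝ := 1 - β₁ with hδ₁
  have hδpos : 0 < δ₁ := by rw [hδ₁]; linarith
  have hδ : 0 ≤ δ₁ := hδpos.le
  set Lx : ℝ := Real.log x with hLx
  have hLx0 : 0 ≤ Lx := by linarith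
  set X : ℕ := ⌊x⌋₊ with hX
  set G := (siftedSet x z).filter (fun n => n ≤ ⌊t⌋₊) with hG
  -- `q₁ ≥ 2`
  have hq2 : 2 ≤ q₁ := by
    by_contra h
    push Not at h
    have hq1 : q₁ = 1 := by have := NeZero.ne q₁; omega
    subst hq1
    exact hχ₁ (Subsingleton.elim _ _)
  have hq0 : (0 : ℝ) < q₁ := by positivity
  have hlogq : 0 < Real.log q₁ := Real.log_pos (by exact_mod_cast hq2)
  -- membership facts
  have hGmem : ∀ n ∈ G, 1 ≤ n ∧ n ≤ X ∧ IsPrimePow n ∧ z < n.minFac := by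
    intro n hn
    rw [hG, mem_filter, mem_siftedSet_iff] at hn
    obtain ⟨⟨⟨h1, h2⟩, hpp, hmin⟩, -⟩ := hn
    exact ⟨by omega, h2, hpp, hmin⟩
  have hXx : (X : ℝ) ≤ x := Nat.floor_le (by linarith)
  have hlogX : Real.log X ≤ Lx := by
    rcases Nat.eq_zero_or_pos X with h0 | hpos
    · rw [h0, Nat.cast_zero, Real.log_zero]; exact hLx0
    · exact Real.log_le_log (by exact_mod_cast hpos) hXx
  have hlogX0 : 0 ≤ Real.log X := Real.log_natCast_nonneg X
  -- pointwise bounds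
  have hprime : ∀ n ∈ G.filter Nat.Prime, dhW χ₁ δ₁ n ^ 2 / n ≤
      Lx ^ 2 * ((if χ₁ (n : ZMod q₁) ≠ -1 then (1 : ℝ) else 0) / n) + δ₁ * Lx ^ 2 * (Λ n / n) := by
    intro n hn
    rw [mem_filter] at hn
    obtain ⟨hnG, hp⟩ := hn
    obtain ⟨hn1, hnX, -, -⟩ := hGmem n hnG
    have hn0 : (0 : ℝ) < n := by exact_mod_cast hn1
    have h1 := dhW_sq_le χ₁ hδ n
    have h2 := one_add_mul_rpow_le_of_prime χ₁ hδ hp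
    have hΛsq : Λ n ^ 2 ≤ Lx ^ 2 := (vonMangoldt_sq_le_log_sq hn1 hnX).trans
      (pow_le_pow_left₀ hlogX0 hlogX 2)
    have hΛeq : Λ n = Real.log n := ArithmeticFunction.vonMangoldt_apply_prime hp
    have hlogn : Real.log n ≤ Lx := (Real.log_le_log hn0 (by exact_mod_cast hnX)).trans hlogX
    have hlogn0 : 0 ≤ Real.log n := Real.log_natCast_nonneg n
    have hind0 : 0 ≤ (if χ₁ (n : ZMod q₁) ≠ -1 then (1 : ℝ) else 0) := by split_ifs <;> norm_num
    have hΛ0 : 0 ≤ Λ n := ArithmeticFunction.vonMangoldt_nonneg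
    have h3 : dhW χ₁ δ₁ n ^ 2 ≤
        Lx ^ 2 * (if χ₁ (n : ZMod q₁) ≠ -1 then (1 : ℝ) else 0) + δ₁ * Lx ^ 2 * Λ n := by
      calc dhW χ₁ δ₁ n ^ 2 ≤ Λ n ^ 2 * ((1 + (χ₁ n).re * (n : ℝ) ^ (-δ₁)) / 2) := h1
        _ ≤ Λ n ^ 2 * ((if χ₁ (n : ZMod q₁) ≠ -1 then (1 : ℝ) else 0) + δ₁ * Real.log n) :=
            mul_le_mul_of_nonneg_left h2 (by positivity)
        _ = Λ n ^ 2 * (if χ₁ (n : ZMod q₁) ≠ -1 then (1 : ℝ) else 0) + δ₁ * (Λ n * Real.log n) * Λ n := by ring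
        _ ≤ Lx ^ 2 * (if χ₁ (n : ZMod q₁) ≠ -1 then (1 : ℝ) else 0) + δ₁ * Lx ^ 2 * Λ n := by
            gcongr
            · calc Λ n * Real.log n ≤ Lx * Lx :=
                  mul_le_mul (hΛeq ▸ hlogn) hlogn hlogn0 hLx0
                _ = Lx ^ 2 := by ring
    have := div_le_div_of_nonneg_right h3 hn0.le
    rw [add_div] at this
    refine this.trans (le_of_eq ?_)
    ring
  have hcomp : ∀ n ∈ G.filter (fun n => ¬ n.Prime), dhW χ₁ δ₁ n ^ 2 / n ≤ Lx ^ 2 * ((1 : ℝ) / n) := by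
    intro n hn
    rw [mem_filter] at hn
    obtain ⟨hnG, -⟩ := hn
    obtain ⟨hn1, hnX, -, -⟩ := hGmem n hnG
    have hn0 : (0 : ℝ) < n := by exact_mod_cast hn1
    have hw := abs_dhW_le χ₁ hδ n
    have h1 : dhW χ₁ δ₁ n ^ 2 ≤ Λ n ^ 2 := by
      rw [← sq_abs (dhW χ₁ δ₁ n)]
      exact pow_le_pow_left₀ (abs_nonneg _) hw 2
    have h2 : Λ n ^ 2 ≤ Lx ^ 2 := (vonMangoldt_sq_le_log_sq hn1 hnX).trans
      (pow_le_pow_left₀ hlogX0 hlogX 2)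
    rw [mul_one_div]
    exact div_le_div_of_nonneg_right (h1.trans h2) hn0.le
  -- the three sums
  -- (i) exceptional primes, via Tao–Teräväinen (3.13) with `ε = 1`
  have hexc : ∑ n ∈ G.filter Nat.Prime, (if χ₁ (n : ZMod q₁) ≠ -1 then (1 : ℝ) else 0) / n ≤ K' * (δ₁ * Lx) := by
    -- rewrite as a sum over the exceptional primes of `G`
    have heq : ∑ n ∈ G.filter Nat.Prime, (if χ₁ (n : ZMod q₁) ≠ -1 then (1 : ℝ) else 0) / n =
        ∑ n ∈ (G.filter Nat.Prime).filter (fun n : ℕ => χ₁ (n : ZMod q₁) ≠ -1), (1 : ℝ) / n := by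
      conv_rhs => rw [sum_filter]
      refine sum_congr rfl fun n _ => ?_
      split_ifs <;> simp
    rw [heq]
    have hsub : (G.filter Nat.Prime).filter (fun n : ℕ => χ₁ (n : ZMod q₁) ≠ -1) ⊆
        excPrimes χ₁ (Ioc ⌊(q₁ : ℝ) ^ ((1 + 1) / 2 : ℝ)⌋₊ ⌊x⌋₊) := by
      intro n hn
      rw [mem_filter, mem_filter] at hn
      obtain ⟨⟨hnG, hp⟩, hne⟩ := hn
      obtain ⟨hn1, hnX, -, hmin⟩ := hGmem n hnG
      rw [mem_excPrimes, mem_Ioc]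
      refine ⟨⟨?_, hnX⟩, hp, hne⟩
      have hfl : ⌊(q₁ : ℝ) ^ ((1 + 1) / 2 : ℝ)⌋₊ = q₁ := by norm_num
      rw [hfl]
      have : n.minFac = n := hp.minFac_eq
      omega
    set η : ℝ := 1 / (δ₁ * Real.log q₁) with hη
    have hδlog : 0 < δ₁ * Real.log q₁ := mul_pos hδpos hlogq
    have hηge : η₀ ≤ η := by
      rw [hη, le_div_iff₀ hδlog]
      have h1 : δ₁ * Real.log q₁ ≤ 1 / η₁ := hsmall
      have h2 : η₀ ≤ η₁ := le_max_left _ _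
      calc η₀ * (δ₁ * Real.log q₁) ≤ η₁ * (1 / η₁) := by
            rcases le_or_gt 0 η₀ with h0 | h0
            · exact mul_le_mul h2 h1 hδlog.le hη₁pos.le
            · have : η₀ * (δ₁ * Real.log q₁) ≤ 0 := mul_nonpos_of_nonpos_of_nonneg h0.le hδlog.le
              have : 0 ≤ η₁ * (1 / η₁) := by positivity
              linarith
        _ = 1 := by field_simp
    have hβ : ((1 - 1 / (η * Real.log q₁) : ℝ) : ℂ) = (β₁ : ℂ) := by
      congr 1
      rw [hη]; field_simp; rw [hδ₁]; ring
    have hzero' : χ₁.LFunction ((1 - 1 / (η * Real.log q₁) : ℝ) : ℂ) = 0 := by rw [hβ]; exact hzero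
    have hxq : (q₁ : ℝ) ^ ((1 + 1) / 2 : ℝ) ≤ x := by
      norm_num
      calc (q₁ : ℝ) ≤ z := by exact_mod_cast hqz
        _ ≤ x := hzx
    have h := hTT q₁ χ₁ hprim hquad η hηge hzero' x hxq
    have hpos : ∀ n ∈ excPrimes χ₁ (Ioc ⌊(q₁ : ℝ) ^ ((1 + 1) / 2 : ℝ)⌋₊ ⌊x⌋₊), (0 : ℝ) ≤ 1 / n :=
      fun n _ => by positivity
    calc ∑ n ∈ (G.filter Nat.Prime).filter (fun n : ℕ => χ₁ (n : ZMod q₁) ≠ -1), (1 : ℝ) / n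
        ≤ ∑ n ∈ excPrimes χ₁ (Ioc ⌊(q₁ : ℝ) ^ ((1 + 1) / 2 : ℝ)⌋₊ ⌊x⌋₊), (1 : ℝ) / n :=
          sum_le_sum_of_subset_of_nonneg hsub fun n hn _ => hpos n hn
      _ ≤ K * (Real.log x / Real.log q₁) / η := h
      _ = K * (δ₁ * Lx) := by rw [hη, hLx]; field_simp
      _ ≤ K' * (δ₁ * Lx) := mul_le_mul_of_nonneg_right (le_max_left _ _) (by positivity)
  -- (ii) `∑ Λ(n)/n` over the primes of `G`
  have hΛsum : ∑ n ∈ G.filter Nat.Prime, Λ n / n ≤ Lx + Real.log 4 + 2 := by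
    have hsub : G.filter Nat.Prime ⊆ Icc 1 X := by
      intro n hn
      obtain ⟨hn1, hnX, -, -⟩ := hGmem n (mem_filter.1 hn).1
      rw [mem_Icc]; exact ⟨hn1, hnX⟩
    calc ∑ n ∈ G.filter Nat.Prime, Λ n / n ≤ ∑ n ∈ Icc 1 X, Λ n / n :=
          sum_le_sum_of_subset_of_nonneg hsub fun n _ _ => by
            exact div_nonneg ArithmeticFunction.vonMangoldt_nonneg (Nat.cast_nonneg n)
      _ ≤ Real.log X + Real.log 4 + 2 := sum_vonMangoldt_div_le X
      _ ≤ Lx + Real.log 4 + 2 := by linarith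
  -- (iii) the proper prime powers of `G`
  have hpp : ∑ n ∈ G.filter (fun n => ¬ n.Prime), (1 : ℝ) / n ≤ 2 / z := by
    have hsub : G.filter (fun n => ¬ n.Prime) ⊆
        (Ioc 0 X).filter (fun n => IsPrimePow n ∧ ¬ n.Prime ∧ z < n.minFac) := by
      intro n hn
      rw [mem_filter] at hn
      obtain ⟨hnG, hnp⟩ := hn
      obtain ⟨hn1, hnX, hppow, hmin⟩ := hGmem n hnG
      rw [mem_filter, mem_Ioc]
      exact ⟨⟨by omega, hnX⟩, hppow, hnp, hmin⟩
    exact (sum_le_sum_of_subset_of_nonneg hsub fun n _ _ => by positivity).trans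
      (sum_inv_properPrimePow_gt_le hz1)
  -- assemble
  have hl4 : Real.log 4 ≤ 2 := by
    have h : Real.log 4 = 2 * Real.log 2 := by
      rw [show (4:ℝ) = 2 ^ 2 by norm_num, Real.log_pow]; norm_num
    rw [h]; have := Real.log_two_lt_d9; linarith
  have hzR : (0 : ℝ) < z := by exact_mod_cast hz1
  rw [← sum_filter_add_sum_filter_not G Nat.Prime]
  calc ∑ n ∈ G.filter Nat.Prime, dhW χ₁ δ₁ n ^ 2 / n +
        ∑ n ∈ G.filter (fun n => ¬ n.Prime), dhW χ₁ δ₁ n ^ 2 / n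
      ≤ ∑ n ∈ G.filter Nat.Prime,
          (Lx ^ 2 * ((if χ₁ (n : ZMod q₁) ≠ -1 then (1 : ℝ) else 0) / n) + δ₁ * Lx ^ 2 * (Λ n / n)) +
        ∑ n ∈ G.filter (fun n => ¬ n.Prime), Lx ^ 2 * ((1 : ℝ) / n) :=
        add_le_add (sum_le_sum hprime) (sum_le_sum hcomp)
    _ = Lx ^ 2 * ∑ n ∈ G.filter Nat.Prime, (if χ₁ (n : ZMod q₁) ≠ -1 then (1 : ℝ) else 0) / n +
        δ₁ * Lx ^ 2 * ∑ n ∈ G.filter Nat.Prime, Λ n / n +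
        Lx ^ 2 * ∑ n ∈ G.filter (fun n => ¬ n.Prime), (1 : ℝ) / n := by
        rw [sum_add_distrib, mul_sum, mul_sum, mul_sum]
    _ ≤ Lx ^ 2 * (K' * (δ₁ * Lx)) + δ₁ * Lx ^ 2 * (Lx + Real.log 4 + 2) + Lx ^ 2 * (2 / z) := by
        gcongr
    _ ≤ (K' + 4) * (δ₁ * Lx ^ 3 + Lx ^ 2 / z) := by
        set A : ℝ := δ₁ * Lx ^ 3 with hA
        set Bz : ℝ := Lx ^ 2 / z with hBz
        have h1 : δ₁ * Lx ^ 2 * (Lx + Real.log 4 + 2) ≤ δ₁ * Lx ^ 2 * (2 * Lx) := by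
          refine mul_le_mul_of_nonneg_left ?_ (by positivity); linarith
        have h1' : δ₁ * Lx ^ 2 * (2 * Lx) = 2 * A := by rw [hA]; ring
        have h2 : 0 ≤ A := by rw [hA]; positivity
        have h3 : 0 ≤ Bz := by rw [hBz]; positivity
        have h4 : 0 ≤ K' * Bz := mul_nonneg hK'0 h3
        have heq : Lx ^ 2 * (K' * (δ₁ * Lx)) + δ₁ * Lx ^ 2 * (Lx + Real.log 4 + 2) +
            Lx ^ 2 * (2 / z) = K' * A + δ₁ * Lx ^ 2 * (Lx + Real.log 4 + 2) + 2 * Bz := by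
          rw [hA, hBz]; ring
        have heq2 : (K' + 4) * (A + Bz) = K' * A + K' * Bz + 4 * A + 4 * Bz := by ring
        rw [heq, heq2]
        linarith

end Literature.NumberTheory.LFunctions.LogFreeDensity
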